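import Literature.IUT.LogThetaLattice.HolomorphicHull
import Literature.IUT.LogThetaLattice.HolomorphicHullClosure
import Literature.IUT.LogThetaLattice.HolomorphicHullUpperProofs
import HarnessLib

/-!
# [IUTchIII] Remark 3.9.5 (iii)–(vii), (ix): small clauses PROVED
# (proof-only companion of `HolomorphicHull.lean`; abc-iut cell, layer L6, slice [IUTchIII] §3)

S. Mochizuki, *Inter-universal Teichmüller theory III*, kurims manuscript (May 2020), §3, Remark 3.9.5,
pp. 126–145 (PRIMS **57** (2021), offset ≈ +420) [claim: Mochizuki2012, status: disputed].  The statement file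
`HolomorphicHull.lean` (abc-iut-L6-t4, p404101) types (i)–(x); its proof companions are
`HolomorphicHullClosure.lean` (p404776), `HolomorphicHullBridge.lean` (p405001),
`HolomorphicHullUpperProofs.lean` (p410462), `HolomorphicHullCaseProofs.lean` (abc-iut-L6-d1, p407016),
`HolomorphicHullSchemaNegative.lean` (abc-iut-f-045, p435460) and campaign-S's model files
`Literature/IUT/LogVolume/{HullModel, HullCaseModel, Xi1Model, Xi1ModelNegative, Xi1ArchModel, Xi3Model,
Xi3ModelHXi}.lean`.  THIS file proves the remaining SMALL printed clauses of (iii)–(vii), (ix) that had no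
kernel token (per-node clause coverage of the cell's node register, nodes IUTchIII:Rmk3.9.5(iii)–(ix)):

* (iii) p. 128: the parenthetical "`(μ^{log}(φ(P)) ≥) μ^{log}(H)`" in the definitions of `Φ(P)`, `Ξ(P)`
  (`logVol_le_hull_of_mem_phiApprox` / `…_xiApprox`, monotone log-volume); "this indeterminacy is compact
  … all possible choices … are contained in the compact set `φ(P)`" (`isCompact_closure_hPhi` / `…_hXi`);
  for the last sentence ("this compactness would not be valid if … one omits the condition `H ⊆ φ(P)`")
  the set-theoretic half: every point of `𝓘^ℚ((−))` lies in SOME hull-set (`exists_isHullSet_mem`,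
  `sUnion_isHullSet_eq_univ`), so that without the condition only the log-volume bound constrains the
  family — and in the genuine model hull-sets through a given point have unbounded log-volume
  (campaign-S `boxLogVolume_hullSet`, `mulLogVolume_eq_neg_ordFun`; not re-proved here).
* (iv) p. 129: "`P ⊆ φ(P) = H_Φ(P)`, as well as … `μ^{log}(P) ≤ μ^{log}(H_Φ(P)) = μ^{log}(φ(P))`"
  (`logVol_le_hPhi_and_eq`).
* (v) p. 130: the "formal intersection" extension — a family of nonempty subsets of `S` maps to the
  constant system `{⊼_S}` in `E ⊼ S`, even when its intersection is empty (`Upper.image_family_eq_point`,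
  `Upper.iInter_image_eq_point`, `Upper.image_iInter_subset_point`).
* (vi) p. 130: "identifying `P` with its various log-volume hull-approximants `∈ Φ(P)` or `∈ Ξ(P)`"
  (`Upper.image_eq_image_of_mem_phiApprox` / `…_xiApprox`); the full "if and only if" for hull-sets
  (`remark395vi_iff_hullSets`); the bounded-family hull `φ(P_B) := ⋂_{H ⊇ P_β ∀β} H` (`subset_hullOfFamily`,
  `hullOfFamily_subset`, `hullOfFamily_eq_sInter_iUnion`) and its JUNCTION with (i):
  `hullOfFamily {hull-sets} P = holomorphicHull O (⋃_β P_β)` for a bounded family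
  (`hullOfFamily_eq_holomorphicHull_iUnion`).
* (vii) (Ob2) p. 131 / (ix) (cQ3) p. 141: "by passing from an arbitrary given region `∈ Preg` to the
  associated hull `φ(P) ∈ Hul`, we obtain a region `φ(P)` that is stabilized by the natural action of
  `𝒪^×_k` … [unlike an arbitrary element `∈ Preg`!]" — the holomorphic hull of EVERY subset is `𝒪`-stable,
  with no well-definedness hypothesis (`holomorphicHull_mul_mem`, `hullOfFamily_hullSets_mul_mem`), and a
  region need not be (`exists_region_not_unit_stable`).

No definitions; elementary set theory.  Nothing here bears on the disputed [IUTchIII] Cor. 3.12 or takes a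
side; typed ≠ discharged; covered ≠ endorsed.  Deliberately NOT here: (Ξ1)–(Ξ3) (campaign-S model files
above), (vii) (Ob1) and (x) (genuine local-field witnesses, separate file), (viii) (expository; index PIN
`Remark395viiiIndex` in `HolomorphicHullBridge.lean`).
-/

namespace Literature.IUT.LogThetaLattice

universe u v w

/-! ### (iii), (iv): log-volume hull-approximants -/

section Approximants

variable {X : Type u} {Hul : Set (Set X)} {φ : Set X → Set X} {μlog : Set X → ℝ}

/-- [IUTchIII] Rmk. 3.9.5 (iii) p. 128, the parenthetical "`(μ^{log}(φ(P)) ≥) μ^{log}(H)`" in the definition of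
`Φ(P)`: for a monotone log-volume every `H ∈ Φ(P)` has `μ^{log}(P) ≤ μ^{log}(H) ≤ μ^{log}(φ(P))` — PROVED.
[claim: Mochizuki2012, status: disputed] -/
theorem logVol_le_hull_of_mem_phiApprox (hmono : ∀ S T : Set X, S ⊆ T → μlog S ≤ μlog T)
    {P H : Set X} (hH : H ∈ PhiApprox Hul φ μlog P) : μlog P ≤ μlog H ∧ μlog H ≤ μlog (φ P) :=
  ⟨hH.2.2, hmono _ _ hH.2.1⟩

/-- [IUTchIII] Rmk. 3.9.5 (iii) p. 128, the parenthetical "`(μ^{log}(φ(P)) ≥) μ^{log}(H) (= μ^{log}(P))`" in the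
definition of `Ξ(P)` — PROVED for a monotone log-volume. [claim: Mochizuki2012, status: disputed] -/
theorem logVol_le_hull_of_mem_xiApprox (hmono : ∀ S T : Set X, S ⊆ T → μlog S ≤ μlog T)
    {P H : Set X} (hH : H ∈ XiApprox Hul φ μlog P) : μlog H = μlog P ∧ μlog H ≤ μlog (φ P) :=
  ⟨hH.2.2, hmono _ _ hH.2.1⟩

/-- [IUTchIII] Rmk. 3.9.5 (iii) p. 128: "this indeterminacy is compact, i.e., in the sense that all possible
choices of an element `∈ Φ(P)` … are contained in the compact set `φ(P)`" — if `φ(P)` is relatively compact then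
so is `H_Φ(P) = ⋃_{H ∈ Φ(P)} H` — PROVED. [claim: Mochizuki2012, status: disputed] -/
theorem isCompact_closure_hPhi [TopologicalSpace X] {P : Set X} (hc : IsCompact (closure (φ P))) :
    IsCompact (closure (HPhi Hul φ μlog P)) :=
  hc.of_isClosed_subset isClosed_closure (closure_mono (hXi_subset_hPhi_subset Hul φ μlog P).2)

/-- [IUTchIII] Rmk. 3.9.5 (iii) p. 128: likewise all choices `∈ Ξ(P)` lie in the compact `φ(P)`: `H_Ξ(P)` is
relatively compact when `φ(P)` is — PROVED. [claim: Mochizuki2012, status: disputed] -/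
theorem isCompact_closure_hXi [TopologicalSpace X] {P : Set X} (hc : IsCompact (closure (φ P))) :
    IsCompact (closure (HXi Hul φ μlog P)) :=
  (isCompact_closure_hPhi (Hul := Hul) (μlog := μlog) hc).of_isClosed_subset isClosed_closure
    (closure_mono (hXi_subset_hPhi_subset Hul φ μlog P).1)

/-- [IUTchIII] Rmk. 3.9.5 (iii) p. 128, last sentence: "this compactness would not be valid if, in the
definition of `Φ(−)` or `Ξ(−)`, one omits the condition `H ⊆ φ(P)`" — the set-theoretic mechanism: WITHOUT that
condition the union of the candidate family is everything as soon as every point lies in a member of `Hul` of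
log-volume `≥ μ^{log}(P)` (in the genuine model every point lies in hull-sets of arbitrarily large log-volume;
cf. `exists_isHullSet_mem` below and campaign-S `boxLogVolume_hullSet`) — PROVED.
[claim: Mochizuki2012, status: disputed] -/
theorem sUnion_volumeFamily_eq_univ {P : Set X}
    (h : ∀ x : X, ∃ H ∈ Hul, x ∈ H ∧ μlog P ≤ μlog H) :
    ⋃₀ {H | H ∈ Hul ∧ μlog P ≤ μlog H} = Set.univ := by
  refine Set.eq_univ_of_forall fun x => ?_
  obtain ⟨H, hH, hx, hle⟩ := h x
  exact Set.mem_sUnion_of_mem hx ⟨hH, hle⟩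

/-- [IUTchIII] Rmk. 3.9.5 (iv) p. 129: "the inclusion `P ⊆ φ(P) = H_Φ(P)`, as well as the induced inequality of
log-volumes `μ^{log}(P) ≤ μ^{log}(H_Φ(P)) = μ^{log}(φ(P))`" — PROVED for a hull map and a monotone log-volume (that
the inequality is in general STRICT is (Ξ3), kernel-computed in campaign-S `Xi3Model.lean`).
[claim: Mochizuki2012, status: disputed] -/
theorem logVol_le_hPhi_and_eq {Preg : Set (Set X)} (hφ : IsHullMap Preg Hul φ)
    (hmono : ∀ S T : Set X, S ⊆ T → μlog S ≤ μlog T) {P : Set X} (hP : P ∈ Preg) :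
    P ⊆ HPhi Hul φ μlog P ∧ μlog P ≤ μlog (HPhi Hul φ μlog P) ∧
      μlog (HPhi Hul φ μlog P) = μlog (φ P) := by
  obtain ⟨-, heq⟩ := hullMap_mem_phiApprox Hul φ μlog hφ hmono hP
  refine ⟨?_, ?_, by rw [← heq]⟩
  · rw [← heq]; exact hφ.P2 P hP
  · rw [← heq]; exact hmono _ _ (hφ.P2 P hP)

end Approximants

/-! ### (iii) last sentence / (vii) (Ob2): every point lies in a hull-set; hulls are `𝒪`-stable -/

section HullSets

variable {ι : Type u} {k : ι → Type v} [∀ i, Field (k i)] (O : ∀ i, Subring (k i))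

open scoped Classical in
/-- Every point of `𝓘^ℚ((−)) ≅ ⊕_i k_i` lies in some hull-set `λ·𝒪` ([IUTchIII] Rmk. 3.9.5 (i) p. 127; used for
(iii) p. 128 "this compactness would not be valid if … one omits the condition `H ⊆ φ(P)`"): take `λ_i := x_i`
where `x_i ≠ 0` and `λ_i := 1` where `x_i = 0` — PROVED. [claim: Mochizuki2012, status: disputed] -/
theorem exists_isHullSet_mem (x : ∀ i, k i) : ∃ H : Set (∀ i, k i), IsHullSet O H ∧ x ∈ H := by
  refine ⟨Set.univ.pi fun i => (fun y => (if x i = 0 then (1 : k i) else x i) * y) '' (O i : Set (k i)),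
    ⟨fun i => if x i = 0 then 1 else x i, fun i => ?_, rfl⟩, fun i _ => ?_⟩
  · show (if x i = 0 then (1 : k i) else x i) ≠ 0
    split_ifs with h
    · exact one_ne_zero
    · exact h
  · by_cases h : x i = 0
    · exact ⟨0, (O i).zero_mem, by simp [h]⟩
    · exact ⟨1, (O i).one_mem, by simp [h]⟩

/-- The hull-sets COVER `𝓘^ℚ((−))`: `⋃ {λ·𝒪} = 𝓘^ℚ((−))` ([IUTchIII] Rmk. 3.9.5 (i), (iii) pp. 127–128) — PROVED.
[claim: Mochizuki2012, status: disputed] -/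
theorem sUnion_isHullSet_eq_univ : ⋃₀ {H : Set (∀ i, k i) | IsHullSet O H} = Set.univ :=
  Set.eq_univ_of_forall fun x => by
    obtain ⟨H, hH, hx⟩ := exists_isHullSet_mem O x
    exact Set.mem_sUnion_of_mem hx hH

/-- **IUTchIII:Rmk3.9.5(vii) (Ob2)** p. 131 (= (ix) (cQ3) p. 141): "by passing from an arbitrary given region
`∈ Preg` to the associated hull `φ(P) ∈ Hul`, we obtain a region `φ(P) ∈ Hul` that is stabilized by the natural
action of `𝒪^×_k`" — the holomorphic hull of EVERY subset `U` (relatively compact or not, well-defined as a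
hull-set or not) is stable under multiplication by `Π_i 𝒪_{k_i}` — PROVED (intersections of `𝒪`-stable sets).
[claim: Mochizuki2012, status: disputed] -/
theorem holomorphicHull_mul_mem [∀ i, TopologicalSpace (k i)] {U : Set (∀ i, k i)} {a x : ∀ i, k i}
    (ha : ∀ i, a i ∈ O i) (hx : x ∈ holomorphicHull O U) : a * x ∈ holomorphicHull O U := by
  unfold holomorphicHull at hx ⊢
  split_ifs with hc
  · rw [if_pos hc] at hx
    exact fun H hH => IsHullSet.mul_mem O hH.1 ha (hx H hH)
  · exact Set.mem_univ _

/-- [IUTchIII] Rmk. 3.9.5 (vii) (Ob5) p. 134 / (ix) (cQ3) p. 141: the hull `φ(P_B)` of a bounded family of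
regions, formed in the hull-sets of `𝓘^ℚ((−))`, is `𝒪`-stable — PROVED (instance of the statement file's
`Remark395ix_stable`). [claim: Mochizuki2012, status: disputed] -/
theorem hullOfFamily_hullSets_mul_mem {B : Type w} (P : B → Set (∀ i, k i)) {a x : ∀ i, k i}
    (ha : ∀ i, a i ∈ O i) (hx : x ∈ hullOfFamily {H | IsHullSet O H} P) :
    a * x ∈ hullOfFamily {H | IsHullSet O H} P :=
  Remark395ix_stable {H | IsHullSet O H} (Set.univ.pi fun i => (O i : Set (k i)))
    (fun _ hH _ ha' _ hy => IsHullSet.mul_mem O hH (fun i => ha' i (Set.mem_univ i)) hy) P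
    (fun i _ => ha i) hx

/-- [IUTchIII] Rmk. 3.9.5 (vii) (Ob2) p. 131, the bracket "[unlike an arbitrary element `∈ Preg`!]" (cf. (Ob1):
an indeterminacy "given by multiplication by `𝒪^×_k` … that does not stabilize `𝓘_k`"): a region need NOT be
stable under the units — abstract witness: if some factor `k_{i₀}` has an element `t ∉ 𝒪` and a unit `u ≠ 1` of
`𝒪` (`u ≠ 0`, `u, u^{-1} ∈ 𝒪`), then `U := Π 𝒪 ∪ {t·e_{i₀}}` and the unit `a := (1, …, u, …, 1)` have
`a·(t e_{i₀}) ∉ U` (in the genuine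
situation: `t = p^{-1}`, `u` any unit `≠ 1`, e.g. the region `P` of the (Ξ3) example) — PROVED.
[claim: Mochizuki2012, status: disputed] -/
theorem exists_region_not_unit_stable [DecidableEq ι] {i₀ : ι} {t u : k i₀} (ht : t ∉ O i₀)
    (hu : u ∈ O i₀) (hu0 : u ≠ 0) (hu' : u⁻¹ ∈ O i₀) (hu1 : u ≠ 1) :
    ∃ U : Set (∀ i, k i), ∃ a x : ∀ i, k i,
      (∀ i, a i ∈ O i ∧ (a i)⁻¹ ∈ O i) ∧ x ∈ U ∧ a * x ∉ U := by
  have ht0 : t ≠ 0 := fun h => ht (h ▸ (O i₀).zero_mem)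
  let x : ∀ i, k i := Pi.single i₀ t
  let a : ∀ i, k i := Function.update 1 i₀ u
  have hax : (a * x) i₀ = u * t := by simp [a, x]
  refine ⟨(Set.univ.pi fun i => (O i : Set (k i))) ∪ {x}, a, x, fun i => ?_, Or.inr rfl, ?_⟩
  · by_cases h : i = i₀
    · subst h
      simp only [a, Function.update_self]
      exact ⟨hu, hu'⟩
    · simp only [a, Function.update_of_ne h, Pi.one_apply, inv_one]
      exact ⟨(O i).one_mem, (O i).one_mem⟩
  · rintro (h | h)
    · have hmem : u * t ∈ O i₀ := hax ▸ h i₀ (Set.mem_univ _)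
      have h2 : u⁻¹ * (u * t) ∈ O i₀ := (O i₀).mul_mem hu' hmem
      rw [← mul_assoc, inv_mul_cancel₀ hu0, one_mul] at h2
      exact ht h2
    · have h' : (a * x) i₀ = x i₀ := congr_fun (Set.mem_singleton_iff.mp h) i₀
      rw [hax] at h'
      simp only [x, Pi.single_eq_same] at h'
      exact hu1 ((mul_left_eq_self₀.mp h').resolve_right ht0)

end HullSets

/-! ### (v): formal intersections map to `⊼_S` -/

section UpperFamilies

variable {E : Type u} (S : Set E)

/-- [IUTchIII] Rmk. 3.9.5 (v) p. 130: a collection of nonempty subsets `S_γ ⊆ S` "induces, upon passing to the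
quotient `E ↠ E ⊼ S`, a system that consists of identity maps between copies of `⊼_S`" — every member maps to
the single point `⊼_S` — PROVED. [claim: Mochizuki2012, status: disputed] -/
theorem Upper.image_family_eq_point {Γ : Type w} (T : Γ → Set E) (hT : ∀ γ, T γ ⊆ S)
    (hne : ∀ γ, (T γ).Nonempty) {s : E} (hs : s ∈ S) (γ : Γ) :
    Upper.mk S '' T γ = {Upper.mk S s} :=
  Upper.image_eq_point S (hT γ) (hne γ) hs

/-- [IUTchIII] Rmk. 3.9.5 (v) p. 130: "this map may be 'extended' to the case where `S_i` … is empty if this `S_i`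
is treated as a 'formal intersection' … of some collection of nonempty subsets of `S`": the intersection of the
IMAGES of such a collection is still the point `⊼_S` (although `⋂_γ S_γ` may be empty) — PROVED.
[claim: Mochizuki2012, status: disputed] -/
theorem Upper.iInter_image_eq_point {Γ : Type w} [Nonempty Γ] (T : Γ → Set E) (hT : ∀ γ, T γ ⊆ S)
    (hne : ∀ γ, (T γ).Nonempty) {s : E} (hs : s ∈ S) :
    ⋂ γ, Upper.mk S '' T γ = {Upper.mk S s} := by
  have : ∀ γ, Upper.mk S '' T γ = {Upper.mk S s} := Upper.image_family_eq_point S T hT hne hs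
  simp only [this, Set.iInter_const]

/-- [IUTchIII] Rmk. 3.9.5 (v) p. 130: "'formal empty sets' `⊆ S` also map to `⊼_S ⊆ E ⊼ S`" — the set-theoretic
intersection `⋂_γ S_γ` (possibly `∅`) of a nonempty collection of subsets of `S` maps INTO `{⊼_S}` — PROVED.
[claim: Mochizuki2012, status: disputed] -/
theorem Upper.image_iInter_subset_point {Γ : Type w} [Nonempty Γ] (T : Γ → Set E) (hT : ∀ γ, T γ ⊆ S)
    {s : E} (hs : s ∈ S) : Upper.mk S '' (⋂ γ, T γ) ⊆ {Upper.mk S s} := by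
  rintro _ ⟨x, hx, rfl⟩
  obtain ⟨γ⟩ := ‹Nonempty Γ›
  exact Quot.sound (Or.inr ⟨hT γ (Set.mem_iInter.mp hx γ), hs⟩)

end UpperFamilies

/-! ### (vi): identifying `P` with its hull-approximants; the `⊼`-criterion "iff"; `φ(P_B)` -/

section Identification

variable {X : Type u} {Hul : Set (Set X)} {φ : Set X → Set X} {μlog : Set X → ℝ}

/-- **IUTchIII:Rmk3.9.5(vi)** p. 130: "the abstract set-theoretic '`⊼`-formalism' of (v) — i.e., where one takes
'`S ⊆ E`' to be `φ(P) ⊆ 𝓘^ℚ((−))` — yields a convenient tool for identifying `P` with its various log-volume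
hull-approximants `∈ Φ(P)` … [all of which are nonempty subsets of `φ(P) ∈ Hul`]": `P` and any nonempty
`H ∈ Φ(P)` have the SAME image in `𝓘^ℚ((−)) ⊼ φ(P)` — PROVED ((P2) `P ⊆ φ(P)` and `H ⊆ φ(P)`).
[claim: Mochizuki2012, status: disputed] -/
theorem Upper.image_eq_image_of_mem_phiApprox {Preg : Set (Set X)} (hφ : IsHullMap Preg Hul φ)
    {P : Set X} (hP : P ∈ Preg) (hPne : P.Nonempty) {H : Set X} (hH : H ∈ PhiApprox Hul φ μlog P)
    (hHne : H.Nonempty) : Upper.mk (φ P) '' P = Upper.mk (φ P) '' H :=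
  Upper.image_eq_image (φ P) (hφ.P2 P hP) hH.2.1 hPne hHne

/-- [IUTchIII] Rmk. 3.9.5 (vi) p. 130: the same identification for the approximants `∈ Ξ(P)` — PROVED.
[claim: Mochizuki2012, status: disputed] -/
theorem Upper.image_eq_image_of_mem_xiApprox {Preg : Set (Set X)} (hφ : IsHullMap Preg Hul φ)
    {P : Set X} (hP : P ∈ Preg) (hPne : P.Nonempty) {H : Set X} (hH : H ∈ XiApprox Hul φ μlog P)
    (hHne : H.Nonempty) : Upper.mk (φ P) '' P = Upper.mk (φ P) '' H :=
  Upper.image_eq_image_of_mem_phiApprox hφ hP hPne (xiApprox_subset_phiApprox Hul φ μlog P hH) hHne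

/-- `P_β ⊆ φ(P_B)` for every member of a bounded family ([IUTchIII] Rmk. 3.9.5 (vi) p. 130, `φ(P_B) :=
⋂_{Hul ∋ H ⊇ P_β, ∀ β ∈ B} H`) — PROVED. [claim: Mochizuki2012, status: disputed] -/
theorem subset_hullOfFamily (Hul : Set (Set X)) {B : Type w} (P : B → Set X) (β : B) :
    P β ⊆ hullOfFamily Hul P :=
  Set.subset_sInter fun _ hH => hH.2 β

/-- `φ(P_B) ⊆ H` for every `H ∈ Hul` containing all the `P_β` ([IUTchIII] Rmk. 3.9.5 (vi) p. 130) — PROVED.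
[claim: Mochizuki2012, status: disputed] -/
theorem hullOfFamily_subset (Hul : Set (Set X)) {B : Type w} (P : B → Set X) {H : Set X} (hH : H ∈ Hul)
    (h : ∀ β, P β ⊆ H) : hullOfFamily Hul P ⊆ H :=
  Set.sInter_subset_of_mem ⟨hH, h⟩

/-- `φ(P_B) = ⋂_{Hul ∋ H ⊇ ⋃_β P_β} H`: the hull of a family is the intersection of the members of `Hul` containing
the UNION of the family ([IUTchIII] Rmk. 3.9.5 (vi) p. 130 "[cf. the representation of `φ(P)` as an
intersection in (ii)]") — PROVED. [claim: Mochizuki2012, status: disputed] -/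
theorem hullOfFamily_eq_sInter_iUnion (Hul : Set (Set X)) {B : Type w} (P : B → Set X) :
    hullOfFamily Hul P = ⋂₀ {H | H ∈ Hul ∧ (⋃ β, P β) ⊆ H} := by
  unfold hullOfFamily
  congr 1
  ext H
  simp only [Set.mem_setOf_eq, Set.iUnion_subset_iff]

end Identification

section FamilyJunction

variable {ι : Type u} {k : ι → Type v} [∀ i, Field (k i)] (O : ∀ i, Subring (k i))

/-- **JUNCTION (vi)/(vii)(Ob5) ↔ (i)**: with `Hul :=` the hull-sets of `𝓘^ℚ((−)) ≅ ⊕_i k_i`, the hull `φ(P_B)` of a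
BOUNDED family ([IUTchIII] Rmk. 3.9.5 (vi) p. 130: "`∪_{β∈B} P_β ⊆ 𝓘^ℚ((−))` is relatively compact") IS the
holomorphic hull (Rmk. 3.9.5 (i)) of the union `⋃_β P_β` — PROVED. (In [IUTchIII] Cor. 3.12 this is "the
holomorphic hull of the union of the possible images".) [claim: Mochizuki2012, status: disputed] -/
theorem hullOfFamily_eq_holomorphicHull_iUnion [∀ i, TopologicalSpace (k i)] {B : Type w}
    (P : B → Set (∀ i, k i)) (hc : IsCompact (closure (⋃ β, P β))) :
    hullOfFamily {H | IsHullSet O H} P = holomorphicHull O (⋃ β, P β) := by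
  rw [hullOfFamily_eq_sInter_iUnion]
  unfold holomorphicHull
  rw [if_pos hc]
  rfl

/-- **IUTchIII:Rmk3.9.5(vi)** p. 130, the full criterion for hull-sets: for DISTINCT hull-sets `H₁, H₂` and a hull-set
`φ(P)`, "images of distinct `H₁, H₂ ∈ Hul` map to the same subset of `𝓘^ℚ((−)) ⊼ φ(P)` if and only if
`H₁, H₂ ⊆ φ(P)`" — PROVED ("if": `Upper.image_eq_image`, hull-sets being nonempty; "only if":
`Remark395vi_onlyIf_hullSets`). [claim: Mochizuki2012, status: disputed] -/
theorem remark395vi_iff_hullSets {φP H₁ H₂ : Set (∀ i, k i)} (hφ : IsHullSet O φP) (h₁ : IsHullSet O H₁)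
    (h₂ : IsHullSet O H₂) (hne : H₁ ≠ H₂) :
    Upper.mk φP '' H₁ = Upper.mk φP '' H₂ ↔ H₁ ⊆ φP ∧ H₂ ⊆ φP := by
  constructor
  · exact Remark395vi_onlyIf_hullSets O hφ H₁ h₁ H₂ h₂ hne
  · rintro ⟨hs₁, hs₂⟩
    exact Upper.image_eq_image φP hs₁ hs₂ ⟨0, IsHullSet.zero_mem O h₁⟩ ⟨0, IsHullSet.zero_mem O h₂⟩

end FamilyJunction

end Literature.IUT.LogThetaLattice
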